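import Summits.QuantumFields.BalabanUV.Beta.KernelWardMColumn
import Summits.QuantumFields.BalabanUV.Beta.GAN24.ContactKernelCells
import Summits.QuantumFields.BalabanUV.Beta.GAN24.BornLambdaContactCells

/-!
# `BalabanUV.Beta.GAN24.MultiplierLegWard` — binder row G-an2-4 / (CONV-C), CT-ROUTE, the row owner's `gen21/BORNV-PLAN-v0.md` §4 «(V-C)» ∕ §2 (V-U):
# **THE DRESSED AND THE UNDRESSED OUTER CHAINS AGREE ON THE MULTIPLIER LEGS** — the V twin of BORNSEC-PLAN v1.1 §0 (c1) «NO vertex cell»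

NOT IN PRINT; OUR BOOKKEEPING (G-an2-4 formalisation swarm → CRUX TEAM (2), leaf prover `b2b-balaban-gan24-formalise-leaf-03`, gen 55; the (C4)-V parts taken
on leaf-02 g49's «NOT MINE — GO, YOURS», journal `CLAIMS.log` l.34851, INTENT l.34914).  [folklore] linear algebra (summation by parts on `ℤ^{d+1}`) over tree
theorems BY NAME: an1's multiplier-column Ward laws `KernelWardMColumn.colM_KInvStep_ward ∕ _ward_resp` (an2's `codiff₁_wΦ_right ∕ _shift`: the multiplier
response `wΦ` is co-closed in both slots), an4's `OneStepKernelFamily.KInvStep_inr_off` ∕ leaf-14's `MultiplierZeroMass.KInvStep_inr_inr_off_right` (the `mm`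
block sits on the coarse sublattice), `RespStepBmDecompPsi.decays_KStepUnit_levels`, leaf-01's `ContactKernelCells.legChain_respStepBmSeq_sub_respStep` (dressed chain −
undressed response = a pure gradient), leaf-02's `BornLambdaContactCells.exists_abs_lineageGauge_le` (the gauge function is bounded, `d = 3`).  0 `def`, 0 cited facts,
0 `def … : Prop`, 0 sorry; asserts nothing of Bałaban's.  HONEST FRAMING (cell contract, verbatim): «discharging `BetaPertH` makes Bałaban's UV stability UNCONDITIONAL — a
real constructive-QFT result; it is NOT the continuum limit and NOT the Clay problem.»  HONEST DEPENDENCY (verbatim): «continuum YM on T⁴ ⇐ BetaPertH ∧ nine spine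
estimates (0/9 proved); BetaPertH ⇐ (D1) ∧ (D4) ∧ CAP+tail; G-an2-4 gates asym, D1 and NE2/3/4.»

## Why ((V-C), located l.34914)
leaf-01's (V-1) contact of a V-born lineage `i < k = i+n+2` is `D_{i,k} − U_{i,k}` with `D = w^{n+1} • push₃ T′ T′ T′ X_i` and `U = w^{k−i} • push₃ B′ B′ B′ Y⁰_i`
(`T′ = legChain (respStepBmSeq ρ Lc) (i+1) n` dressed, `B′ = respStep (Lc^(i+1)) (Lc^k)` undressed); after nesting (`Push3Nest.push₃_push₃`) the MULTIPLIER-slot legs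
of the two mixed pushes are the composites `legComp (colM K̃_i Lc) T′` vs `legComp (colM K̃_i Lc) B′` (channel fm) and `legComp (rowMM K̃_i Lc) T′` vs
`legComp (rowMM K̃_i Lc) B′` (channel mf), `K̃_i = KStepUnit Lc i`.  THIS FILE: they are EQUAL — so the V contact has NO multiplier-slot cell and (V-C) is exactly
the two-field-slot pattern of leaf-02's `ContactBorderKernelCells` with a COMMON (dressed or undressed, at will) multiplier leg.

## What (generic `d` unless said)
* §1 [folklore] summation by parts: `tsum_sum_dz_mul_eq_zero` (a bounded `f` against a summable family `M l v` CO-CLOSED in `(l, v)`: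
  `Σ'_v Σ_l (f (v + e_l) − f v)·M l v = 0`) and **`legComp_eq_of_sub_eq_dz`**: `T − B = (μ z κ u ↦ dz (λ μ z) κ u)` with `λ` bounded, `M` summable and
  co-closed in its OUTPUT index ⇒ `legComp M T = legComp M B` (no hypothesis on `B`).
* §2 the multiplier-slot legs of `K̃_i`: `colM_KStepUnit_apply` ∕ `rowMM_KStepUnit_apply` (unit scalars × the `mm` block of `KInvStep Lc i`), their OUTPUT-index
  co-closedness **`sum_colM_KStepUnit_sub_eq_zero`** (`Σ_β (colM K̃_i Lc β (z′ − e_β) μ z − colM K̃_i Lc β z′ μ z) = 0` — `colM_KInvStep_ward`, SOURCE slot) and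
  **`sum_rowMM_KStepUnit_sub_eq_zero`** (`_ward_resp`, RESPONSE slot), and their output-index summability.
* §3 **`legComp_colM_KStepUnit_eq_of_sub_eq_dz`** ∕ **`legComp_rowMM_KStepUnit_eq_of_sub_eq_dz`** (any `T, B` with `T − B = dz λ`, `λ` bounded), and THE LINEAGE
  INSTANCES **`legComp_colM_legChain_eq_respStep`** ∕ **`legComp_rowMM_legChain_eq_respStep`** (generic `d`, the gauge bound a HYPOTHESIS) and
  **`legComp_colM_legChain_eq_respStep_three`** ∕ **`legComp_rowMM_legChain_eq_respStep_three`** (`d = 3`, `2 ≤ Lc`, hypothesis-free):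
  `legComp (colM (KStepUnit Lc i) Lc) (legChain (respStepBmSeq ρ Lc) (i+1) n) = legComp (colM (KStepUnit Lc i) Lc) (respStep (Lc^(i+1)) (Lc^(i+1+n+1)))`.
USE ((C4)-V, leaf-03; (V-U), owner): the V contact per lineage = leaf-02's two one-gauge border cells per channel with the COMMON tent `legComp (colM K̃_i Lc) T′`;
the undressed row's multiplier leg may be read dressed or undressed.  Discharges NO letter; hCv ∕ hV ∕ hB ∕ hS0-comb OPEN; NEVER «G-an2-4 closed» as (CONV-C); NOT
D1, NOT BetaPertH, NOT continuum, NOT Clay.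
Unit `b2b-balaban-gan24-formalise-leaf-03` (gen 55), 2026-08-21.
-/

noncomputable section

open Finset
open scoped BigOperators
open Literature.MathematicalPhysics.QuantumFieldTheory
open Literature.MathematicalPhysics.QuantumFieldTheory.Balaban1983to89
open Literature.MathematicalPhysics.QuantumFieldTheory.Balaban1983to89.Beta
open Literature.Probability.LatticeModels (Torus.proj)
open ExpKernelCalculus (MKer Decays)
open AffineAveraging (Site box toSite unitVec dz)
open AveragingWardStencils (b6UnitVec_eq)
open OneStepResolventKernel (Fib KInv eq_zsmul_quo_of_proj)
open OneStepKernelFamily (KInvStep KInvStep_inr_off decays_KInvStep)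
open BalabanCompositeJets (respStep)
open Summit.QuantumFields.BalabanUV.Beta.HessKerDressedUnits (unitK unitK_apply legScale_inr)
open Summit.QuantumFields.BalabanUV.Beta.KernelWardMColumn (colM_KInvStep_ward colM_KInvStep_ward_resp)
open Summit.QuantumFields.BalabanUV.Beta.GAN24.CombesThomas (sfStep smStep KStepUnit)
open Summit.QuantumFields.BalabanUV.Beta.GAN24.SrecUnits (KStepUnit_eq)
open Summit.QuantumFields.BalabanUV.Beta.GAN24.Push4 (legComp legComp_apply)
open Summit.QuantumFields.BalabanUV.Beta.GAN24.Push4Iter (LegFam legChain)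
open Summit.QuantumFields.BalabanUV.Beta.GAN24.SrecLinearPartEq (colM rowMM colM_apply rowMM_apply summable_row_of_decays summable_col_of_decays)
open Summit.QuantumFields.BalabanUV.Beta.GAN24.MultiplierZeroMass (KInvStep_inr_inr_off_right)
open Summit.QuantumFields.BalabanUV.Beta.GAN24.RespStepBmDecompPsi (Psi decays_KStepUnit_levels)
open Summit.QuantumFields.BalabanUV.Beta.GAN24.RespStepBmDecompExact (respStepBmSeq)
open Summit.QuantumFields.BalabanUV.Beta.GAN24.ContactKernelCells (legChain_respStepBmSeq_sub_respStep)
open Summit.QuantumFields.BalabanUV.Beta.GAN24.BornLambdaContactCells (exists_abs_lineageGauge_le)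
open Summit.QuantumFields.BalabanUV.Beta.AxialProjectorBlockMean (bmGaugeAt)
open KKTFluctuationKernel (delta1)

namespace Summit.QuantumFields.BalabanUV.Beta.GAN24.MultiplierLegWard

variable {d : ℕ}

/-! ## §1 Summation by parts: a gradient leg composed with a co-closed leg vanishes -/

/-- [folklore] Shifting a lattice series: `Σ'_v f (v + e)·g v = Σ'_v f v·g (v − e)`. -/
theorem tsum_shift_mul (f g : (Fin (d + 1) → ℤ) → ℝ) (e : Fin (d + 1) → ℤ) :
    ∑' v : Fin (d + 1) → ℤ, f (v + e) * g v = ∑' v : Fin (d + 1) → ℤ, f v * g (v - e) := by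
  rw [← Equiv.tsum_eq (Equiv.subRight e) (fun v => f (v + e) * g v)]
  simp only [Equiv.subRight_apply, sub_add_cancel]

/-- [folklore] **SUMMATION BY PARTS AGAINST A CO-CLOSED FAMILY**: if `f` is bounded, every `M l` is summable and `Σ_l (M l (v − e_l) − M l v) = 0` for all `v`
(the lattice co-differential of the one-form `(l, v) ↦ M l v` vanishes), then `Σ'_v Σ_l (f (v + e_l) − f v)·M l v = 0`. -/
theorem tsum_sum_dz_mul_eq_zero {f : (Fin (d + 1) → ℤ) → ℝ} {C : ℝ} (hf : ∀ v, |f v| ≤ C)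
    {M : Fin (d + 1) → (Fin (d + 1) → ℤ) → ℝ} (hMs : ∀ l, Summable (M l))
    (hM0 : ∀ v, ∑ l, (M l (v - unitVec l) - M l v) = 0) :
    ∑' v : Fin (d + 1) → ℤ, ∑ l, (f (v + unitVec l) - f v) * M l v = 0 := by
  -- summability of the pieces
  have hb : ∀ (g : (Fin (d + 1) → ℤ) → ℝ), Summable g → ∀ e : Fin (d + 1) → ℤ, Summable fun v => f (v + e) * g v := by
    intro g hg e
    refine Summable.of_norm_bounded (hg.abs.mul_left C) (fun v => ?_)
    rw [Real.norm_eq_abs, abs_mul]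
    exact mul_le_mul_of_nonneg_right (hf _) (abs_nonneg _)
  have hMs' : ∀ l, Summable fun v => M l (v - unitVec l) := fun l =>
    (Equiv.subRight (unitVec l)).summable_iff.2 (hMs l)
  have h1 : ∀ l, Summable fun v => f (v + unitVec l) * M l v := fun l => hb _ (hMs l) _
  have h2 : ∀ l, Summable fun v => f v * M l v := fun l => by simpa using hb _ (hMs l) 0
  have h3 : ∀ l, Summable fun v => f v * M l (v - unitVec l) := fun l => by simpa using hb _ (hMs' l) 0
  have hsub : ∀ l, Summable fun v => (f (v + unitVec l) - f v) * M l v := fun l => by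
    simpa only [sub_mul] using (h1 l).sub (h2 l)
  have hsub' : ∀ l, Summable fun v => f v * (M l (v - unitVec l) - M l v) := fun l => by
    simpa only [mul_sub] using (h3 l).sub (h2 l)
  calc ∑' v : Fin (d + 1) → ℤ, ∑ l, (f (v + unitVec l) - f v) * M l v
      = ∑ l, ∑' v : Fin (d + 1) → ℤ, (f (v + unitVec l) - f v) * M l v := Summable.tsum_finsetSum fun l _ => hsub l
    _ = ∑ l, ∑' v : Fin (d + 1) → ℤ, f v * (M l (v - unitVec l) - M l v) := by
        refine Finset.sum_congr rfl fun l _ => ?_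
        calc ∑' v : Fin (d + 1) → ℤ, (f (v + unitVec l) - f v) * M l v
            = ∑' v : Fin (d + 1) → ℤ, (f (v + unitVec l) * M l v - f v * M l v) := by simp only [sub_mul]
          _ = (∑' v : Fin (d + 1) → ℤ, f (v + unitVec l) * M l v) - ∑' v : Fin (d + 1) → ℤ, f v * M l v := (h1 l).tsum_sub (h2 l)
          _ = (∑' v : Fin (d + 1) → ℤ, f v * M l (v - unitVec l)) - ∑' v : Fin (d + 1) → ℤ, f v * M l v := by rw [tsum_shift_mul]
          _ = ∑' v : Fin (d + 1) → ℤ, (f v * M l (v - unitVec l) - f v * M l v) := ((h3 l).tsum_sub (h2 l)).symm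
          _ = ∑' v : Fin (d + 1) → ℤ, f v * (M l (v - unitVec l) - M l v) := by simp only [mul_sub]
    _ = ∑' v : Fin (d + 1) → ℤ, ∑ l, f v * (M l (v - unitVec l) - M l v) := (Summable.tsum_finsetSum fun l _ => hsub' l).symm
    _ = ∑' v : Fin (d + 1) → ℤ, f v * ∑ l, (M l (v - unitVec l) - M l v) := by simp only [Finset.mul_sum]
    _ = 0 := by simp only [hM0, mul_zero, tsum_zero]

/-- NOT IN PRINT; OUR BOOKKEEPING ([folklore]).  **A GRADIENT LEG COMPOSED WITH A CO-CLOSED LEG IS INVISIBLE**: if two outer legs differ by a pure gradient in their input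
index, `T − B = (μ z κ u ↦ dz (λ μ z) κ u)` with `λ` bounded, and the inner leg `M` is summable and co-closed in its OUTPUT index
(`Σ_l (M l (v − e_l) κ u − M l v κ u) = 0`), then `legComp M T = legComp M B` — NO hypothesis on `B` (if the `B`-series diverges both sides are the same junk value). -/
theorem legComp_eq_of_sub_eq_dz {T B M : LegFam d} {lam : Fin (d + 1) → (Fin (d + 1) → ℤ) → (Fin (d + 1) → ℤ) → ℝ} {Clam : ℝ}
    (hTB : T - B = fun μ z κ u => dz (lam μ z) κ u) (hlam : ∀ μ z u, |lam μ z u| ≤ Clam)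
    (hMs : ∀ l κ u, Summable fun v => M l v κ u) (hM0 : ∀ κ u v, ∑ l, (M l (v - unitVec l) κ u - M l v κ u) = 0) :
    legComp M T = legComp M B := by
  funext μ z κ u
  rw [legComp_apply, legComp_apply]
  have eT : ∀ l v, T μ z l v = B μ z l v + (lam μ z (v + unitVec l) - lam μ z v) := by
    intro l v
    have h := congrFun (congrFun (congrFun (congrFun hTB μ) z) l) v
    simp only [Pi.sub_apply, dz] at h
    linarith
  have hg : Summable fun v : Fin (d + 1) → ℤ => ∑ l, (lam μ z (v + unitVec l) - lam μ z v) * M l v κ u := by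
    refine summable_sum fun l _ => ?_
    have ha : Summable fun v => lam μ z (v + unitVec l) * M l v κ u := by
      refine Summable.of_norm_bounded ((hMs l κ u).abs.mul_left Clam) (fun v => ?_)
      rw [Real.norm_eq_abs, abs_mul]
      exact mul_le_mul_of_nonneg_right (hlam _ _ _) (abs_nonneg _)
    have hb : Summable fun v => lam μ z v * M l v κ u := by
      refine Summable.of_norm_bounded ((hMs l κ u).abs.mul_left Clam) (fun v => ?_)
      rw [Real.norm_eq_abs, abs_mul]
      exact mul_le_mul_of_nonneg_right (hlam _ _ _) (abs_nonneg _)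
    simpa only [sub_mul] using ha.sub hb
  have hg0 : ∑' v : Fin (d + 1) → ℤ, ∑ l, (lam μ z (v + unitVec l) - lam μ z v) * M l v κ u = 0 :=
    tsum_sum_dz_mul_eq_zero (hlam μ z) (fun l => hMs l κ u) (hM0 κ u)
  have esum : ∀ v, ∑ l, T μ z l v * M l v κ u = (∑ l, B μ z l v * M l v κ u) + ∑ l, (lam μ z (v + unitVec l) - lam μ z v) * M l v κ u := by
    intro v
    rw [← Finset.sum_add_distrib]
    exact Finset.sum_congr rfl fun l _ => by rw [eT]; ring
  simp_rw [esum]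
  by_cases hB : Summable fun v : Fin (d + 1) → ℤ => ∑ l, B μ z l v * M l v κ u
  · rw [hB.tsum_add hg, hg0, add_zero]
  · have hnot : ¬Summable fun v : Fin (d + 1) → ℤ =>
        (∑ l, B μ z l v * M l v κ u) + ∑ l, (lam μ z (v + unitVec l) - lam μ z v) * M l v κ u := by
      intro h
      exact hB (by simpa using h.sub hg)
    rw [tsum_eq_zero_of_not_summable hnot, tsum_eq_zero_of_not_summable hB]

/-! ## §2 The multiplier-slot legs of `K̃_i = KStepUnit Lc i`: entries, co-closedness, summability -/

section Legs

variable {Lc : ℕ} [NeZero Lc]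

/-- [folklore] The mm-column leg of the unit step kernel: `colM (KStepUnit Lc i) Lc β z′ μ z = s_m·KInvStep Lc i z (Lc•z′) (inr μ) (inr β)·s_m`. -/
theorem colM_KStepUnit_apply (i : ℕ) (β : Fin (d + 1)) (z' : Fin (d + 1) → ℤ) (μ : Fin (d + 1)) (z : Fin (d + 1) → ℤ) :
    colM (KStepUnit (d := d) Lc i) Lc β z' μ z
      = smStep d Lc i * KInvStep (d := d) Lc i z ((Lc : ℤ) • z') (Sum.inr μ) (Sum.inr β) * smStep d Lc i := by
  rw [colM_apply, KStepUnit_eq, unitK_apply, legScale_inr, legScale_inr]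

/-- [folklore] The mm-row leg of the unit step kernel: `rowMM (KStepUnit Lc i) Lc α x′ μ x = s_m·KInvStep Lc i (Lc•x′) x (inr α) (inr μ)·s_m`. -/
theorem rowMM_KStepUnit_apply (i : ℕ) (α : Fin (d + 1)) (x' : Fin (d + 1) → ℤ) (μ : Fin (d + 1)) (x : Fin (d + 1) → ℤ) :
    rowMM (KStepUnit (d := d) Lc i) Lc α x' μ x
      = smStep d Lc i * KInvStep (d := d) Lc i ((Lc : ℤ) • x') x (Sum.inr α) (Sum.inr μ) * smStep d Lc i := by
  rw [rowMM_apply, KStepUnit_eq, unitK_apply, legScale_inr, legScale_inr]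

/-- NOT IN PRINT; OUR BOOKKEEPING ([folklore]; an1's `KernelWardMColumn.colM_KInvStep_ward`, SOURCE slot).  **THE mm-COLUMN LEG IS CO-CLOSED IN ITS OUTPUT INDEX**:
`Σ_β (colM K̃_i Lc β (z′ − e_β) μ z − colM K̃_i Lc β z′ μ z) = 0` for every multiplier index `(μ, z)` — at a coarse `z = Lc•w` the entries are an2's
`wΦ^{(Lc^{i+1})} μ β (w − z′)` (co-closed in `(β, z′)`), off the coarse sublattice they vanish. -/
theorem sum_colM_KStepUnit_sub_eq_zero (i : ℕ) (μ : Fin (d + 1)) (z z' : Fin (d + 1) → ℤ) :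
    ∑ β, (colM (KStepUnit (d := d) Lc i) Lc β (z' - unitVec β) μ z - colM (KStepUnit (d := d) Lc i) Lc β z' μ z) = 0 := by
  by_cases hz : Torus.proj Lc z = 0
  · have ez := eq_zsmul_quo_of_proj (N := Lc) hz
    set w := LatticeForm.quo Lc z with hw
    rw [ez]
    simp only [colM_KStepUnit_apply]
    have h := colM_KInvStep_ward (d := d) (Lc := Lc) i z' μ w
    simp only [SecondOrderResponse.colM, b6UnitVec_eq] at h
    calc ∑ β, (smStep d Lc i * KInvStep (d := d) Lc i ((Lc : ℤ) • w) ((Lc : ℤ) • (z' - unitVec β)) (Sum.inr μ) (Sum.inr β) * smStep d Lc i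
            - smStep d Lc i * KInvStep (d := d) Lc i ((Lc : ℤ) • w) ((Lc : ℤ) • z') (Sum.inr μ) (Sum.inr β) * smStep d Lc i)
        = (smStep d Lc i * smStep d Lc i) * ∑ β, (KInvStep (d := d) Lc i ((Lc : ℤ) • w) ((Lc : ℤ) • (z' - unitVec β)) (Sum.inr μ) (Sum.inr β)
            - KInvStep (d := d) Lc i ((Lc : ℤ) • w) ((Lc : ℤ) • z') (Sum.inr μ) (Sum.inr β)) := by
          rw [Finset.mul_sum]
          exact Finset.sum_congr rfl fun β _ => by ring
      _ = 0 := by rw [h, mul_zero]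
  · refine Finset.sum_eq_zero fun β _ => ?_
    simp only [colM_KStepUnit_apply, KInvStep_inr_off i hz, mul_zero, zero_mul, sub_self]

/-- NOT IN PRINT; OUR BOOKKEEPING ([folklore]; an1's `KernelWardMColumn.colM_KInvStep_ward_resp`, RESPONSE slot).  **THE mm-ROW LEG IS CO-CLOSED IN ITS OUTPUT INDEX**:
`Σ_α (rowMM K̃_i Lc α (x′ − e_α) μ x − rowMM K̃_i Lc α x′ μ x) = 0` for every multiplier index `(μ, x)`. -/
theorem sum_rowMM_KStepUnit_sub_eq_zero (i : ℕ) (μ : Fin (d + 1)) (x x' : Fin (d + 1) → ℤ) :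
    ∑ α, (rowMM (KStepUnit (d := d) Lc i) Lc α (x' - unitVec α) μ x - rowMM (KStepUnit (d := d) Lc i) Lc α x' μ x) = 0 := by
  by_cases hx : Torus.proj Lc x = 0
  · have ex := eq_zsmul_quo_of_proj (N := Lc) hx
    set w := LatticeForm.quo Lc x with hw
    rw [ex]
    simp only [rowMM_KStepUnit_apply]
    have h := colM_KInvStep_ward_resp (d := d) (Lc := Lc) i μ w x'
    simp only [SecondOrderResponse.colM, b6UnitVec_eq] at h
    calc ∑ α, (smStep d Lc i * KInvStep (d := d) Lc i ((Lc : ℤ) • (x' - unitVec α)) ((Lc : ℤ) • w) (Sum.inr α) (Sum.inr μ) * smStep d Lc i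
            - smStep d Lc i * KInvStep (d := d) Lc i ((Lc : ℤ) • x') ((Lc : ℤ) • w) (Sum.inr α) (Sum.inr μ) * smStep d Lc i)
        = (smStep d Lc i * smStep d Lc i) * ∑ α, (KInvStep (d := d) Lc i ((Lc : ℤ) • (x' - unitVec α)) ((Lc : ℤ) • w) (Sum.inr α) (Sum.inr μ)
            - KInvStep (d := d) Lc i ((Lc : ℤ) • x') ((Lc : ℤ) • w) (Sum.inr α) (Sum.inr μ)) := by
          rw [Finset.mul_sum]
          exact Finset.sum_congr rfl fun α _ => by ring
      _ = 0 := by rw [h, mul_zero]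
  · refine Finset.sum_eq_zero fun α _ => ?_
    simp only [rowMM_KStepUnit_apply, KInvStep_inr_inr_off_right i hx, mul_zero, zero_mul, sub_self]

/-- [folklore] `v ↦ Lc • v` is injective on the lattice. -/
theorem zsmul_injective : Function.Injective fun v : Fin (d + 1) → ℤ => (Lc : ℤ) • v :=
  smul_right_injective (Fin (d + 1) → ℤ) (by exact_mod_cast (NeZero.ne Lc) : (Lc : ℤ) ≠ 0)

/-- [folklore] The mm-column leg is summable in its OUTPUT site index (the decay of `K̃_i` along the coarse sublattice). -/
theorem summable_colM_KStepUnit_out (i : ℕ) (β : Fin (d + 1)) (μ : Fin (d + 1)) (z : Fin (d + 1) → ℤ) :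
    Summable fun z' : Fin (d + 1) → ℤ => colM (KStepUnit (d := d) Lc i) Lc β z' μ z := by
  obtain ⟨C, m, hm, hK⟩ := decays_KStepUnit_levels (d := d) (Lc := Lc) i
  have h := (summable_row_of_decays hK hm z (Sum.inr μ) (Sum.inr β)).comp_injective (zsmul_injective (Lc := Lc))
  simp only [Function.comp_def] at h
  simpa only [colM_apply] using h

/-- [folklore] The mm-row leg is summable in its OUTPUT site index. -/
theorem summable_rowMM_KStepUnit_out (i : ℕ) (α : Fin (d + 1)) (μ : Fin (d + 1)) (x : Fin (d + 1) → ℤ) :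
    Summable fun x' : Fin (d + 1) → ℤ => rowMM (KStepUnit (d := d) Lc i) Lc α x' μ x := by
  obtain ⟨C, m, hm, hK⟩ := decays_KStepUnit_levels (d := d) (Lc := Lc) i
  have h := (summable_col_of_decays hK hm x (Sum.inr α) (Sum.inr μ)).comp_injective (zsmul_injective (Lc := Lc))
  simp only [Function.comp_def] at h
  simpa only [rowMM_apply] using h

end Legs

/-! ## §3 The dressed and the undressed outer chains agree on the multiplier legs -/

section Agree

variable {Lc : ℕ} [NeZero Lc]

/-- NOT IN PRINT; OUR BOOKKEEPING ([folklore]).  **ANY TWO OUTER LEGS DIFFERING BY A BOUNDED PURE GRADIENT AGREE ON THE mm-COLUMN LEG**: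
`T − B = dz λ`, `λ` bounded ⇒ `legComp (colM K̃_i Lc) T = legComp (colM K̃_i Lc) B`. -/
theorem legComp_colM_KStepUnit_eq_of_sub_eq_dz (i : ℕ) {T B : LegFam d} {lam : Fin (d + 1) → (Fin (d + 1) → ℤ) → (Fin (d + 1) → ℤ) → ℝ}
    {Clam : ℝ} (hTB : T - B = fun μ z κ u => dz (lam μ z) κ u) (hlam : ∀ μ z u, |lam μ z u| ≤ Clam) :
    legComp (colM (KStepUnit (d := d) Lc i) Lc) T = legComp (colM (KStepUnit (d := d) Lc i) Lc) B :=
  legComp_eq_of_sub_eq_dz hTB hlam (fun β μ z => summable_colM_KStepUnit_out i β μ z) (fun μ z z' => sum_colM_KStepUnit_sub_eq_zero i μ z z')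

/-- NOT IN PRINT; OUR BOOKKEEPING ([folklore]).  **… AND ON THE mm-ROW LEG**: `T − B = dz λ`, `λ` bounded ⇒ `legComp (rowMM K̃_i Lc) T = legComp (rowMM K̃_i Lc) B`. -/
theorem legComp_rowMM_KStepUnit_eq_of_sub_eq_dz (i : ℕ) {T B : LegFam d} {lam : Fin (d + 1) → (Fin (d + 1) → ℤ) → (Fin (d + 1) → ℤ) → ℝ}
    {Clam : ℝ} (hTB : T - B = fun μ z κ u => dz (lam μ z) κ u) (hlam : ∀ μ z u, |lam μ z u| ≤ Clam) :
    legComp (rowMM (KStepUnit (d := d) Lc i) Lc) T = legComp (rowMM (KStepUnit (d := d) Lc i) Lc) B :=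
  legComp_eq_of_sub_eq_dz hTB hlam (fun α μ x => summable_rowMM_KStepUnit_out i α μ x) (fun μ x x' => sum_rowMM_KStepUnit_sub_eq_zero i μ x x')

/-- NOT IN PRINT; OUR BOOKKEEPING ([folklore]; generic `d`, the gauge bound a HYPOTHESIS).  **THE DRESSED OUTER CHAIN AND THE UNDRESSED RESPONSE AGREE ON THE
mm-COLUMN LEG OF THE BIRTH LEVEL**: with `T′ = legChain (respStepBmSeq ρ Lc) (i+1) n` and `B′ = respStep (Lc^(i+1)) (Lc^(i+1+n+1))` (leaf-01's
`legChain_respStepBmSeq_sub_respStep`: `T′ − B′ = dz λ′`), if the lineage gauge `λ′` is bounded then `legComp (colM K̃_i Lc) T′ = legComp (colM K̃_i Lc) B′`. -/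
theorem legComp_colM_legChain_eq_respStep {rr : Fin (d + 1) → ℕ} (hrr : rr ∈ box (d + 1) Lc) (i n : ℕ) {Clam : ℝ}
    (hlam : ∀ (μ : Fin (d + 1)) (z u : Site (d + 1)),
      |(Psi (toSite rr) Lc (i + 1) n (delta1 μ z) - bmGaugeAt (toSite rr) (respStep (d := d) (Lc ^ (i + 1)) (Lc ^ (i + 1 + n + 1)) μ z) Lc) u| ≤ Clam) :
    legComp (colM (KStepUnit (d := d) Lc i) Lc) (legChain (respStepBmSeq (d := d) (toSite rr) Lc) (i + 1) n)
      = legComp (colM (KStepUnit (d := d) Lc i) Lc) (respStep (d := d) (Lc ^ (i + 1)) (Lc ^ (i + 1 + n + 1))) :=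
  legComp_colM_KStepUnit_eq_of_sub_eq_dz i (legChain_respStepBmSeq_sub_respStep hrr (i + 1) n) hlam

/-- NOT IN PRINT; OUR BOOKKEEPING ([folklore]; generic `d`, the gauge bound a HYPOTHESIS).  **… AND ON THE mm-ROW LEG OF THE BIRTH LEVEL.** -/
theorem legComp_rowMM_legChain_eq_respStep {rr : Fin (d + 1) → ℕ} (hrr : rr ∈ box (d + 1) Lc) (i n : ℕ) {Clam : ℝ}
    (hlam : ∀ (μ : Fin (d + 1)) (z u : Site (d + 1)),
      |(Psi (toSite rr) Lc (i + 1) n (delta1 μ z) - bmGaugeAt (toSite rr) (respStep (d := d) (Lc ^ (i + 1)) (Lc ^ (i + 1 + n + 1)) μ z) Lc) u| ≤ Clam) :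
    legComp (rowMM (KStepUnit (d := d) Lc i) Lc) (legChain (respStepBmSeq (d := d) (toSite rr) Lc) (i + 1) n)
      = legComp (rowMM (KStepUnit (d := d) Lc i) Lc) (respStep (d := d) (Lc ^ (i + 1)) (Lc ^ (i + 1 + n + 1))) :=
  legComp_rowMM_KStepUnit_eq_of_sub_eq_dz i (legChain_respStepBmSeq_sub_respStep hrr (i + 1) n) hlam

end Agree

/-! ## §4 `d = 3`, `2 ≤ Lc`: hypothesis-free (leaf-02's lineage gauge bound) -/

section Three

variable {Lc : ℕ} [NeZero Lc]

/-- NOT IN PRINT; OUR BOOKKEEPING ([folklore]; `d = 3`, `2 ≤ Lc`, every in-block root, every lineage).  **THE DRESSED OUTER CHAIN AND THE UNDRESSED RESPONSE AGREE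
ON THE mm-COLUMN LEG** — the multiplier-slot cell of the V contact VANISHES: `legComp (colM K̃_i Lc) T′ = legComp (colM K̃_i Lc) B′` with
`T′ = legChain (respStepBmSeq ρ Lc) (i+1) n`, `B′ = respStep (Lc^(i+1)) (Lc^(i+1+n+1))` (the gauge bound is leaf-02's `BornLambdaContactCells.exists_abs_lineageGauge_le`). -/
theorem legComp_colM_legChain_eq_respStep_three (hLc : 2 ≤ Lc) {rr : Fin (3 + 1) → ℕ} (hrr : rr ∈ box (3 + 1) Lc) (i n : ℕ) :
    legComp (colM (KStepUnit (d := 3) Lc i) Lc) (legChain (respStepBmSeq (d := 3) (toSite rr) Lc) (i + 1) n)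
      = legComp (colM (KStepUnit (d := 3) Lc i) Lc) (respStep (d := 3) (Lc ^ (i + 1)) (Lc ^ (i + 1 + n + 1))) := by
  obtain ⟨K, -, hK⟩ := exists_abs_lineageGauge_le (Lc := Lc) hLc
  exact legComp_colM_legChain_eq_respStep hrr i n (fun μ z u => hK rr hrr (i + 1) n μ z u)

/-- NOT IN PRINT; OUR BOOKKEEPING ([folklore]; `d = 3`, `2 ≤ Lc`).  **… AND ON THE mm-ROW LEG**: `legComp (rowMM K̃_i Lc) T′ = legComp (rowMM K̃_i Lc) B′`. -/
theorem legComp_rowMM_legChain_eq_respStep_three (hLc : 2 ≤ Lc) {rr : Fin (3 + 1) → ℕ} (hrr : rr ∈ box (3 + 1) Lc) (i n : ℕ) :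
    legComp (rowMM (KStepUnit (d := 3) Lc i) Lc) (legChain (respStepBmSeq (d := 3) (toSite rr) Lc) (i + 1) n)
      = legComp (rowMM (KStepUnit (d := 3) Lc i) Lc) (respStep (d := 3) (Lc ^ (i + 1)) (Lc ^ (i + 1 + n + 1))) := by
  obtain ⟨K, -, hK⟩ := exists_abs_lineageGauge_le (Lc := Lc) hLc
  exact legComp_rowMM_legChain_eq_respStep hrr i n (fun μ z u => hK rr hrr (i + 1) n μ z u)

end Three

end Summit.QuantumFields.BalabanUV.Beta.GAN24.MultiplierLegWard

end
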